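import Literature.MathematicalPhysics.QuantumFieldTheory.Balaban1983to89.T4AxialGaugeFixing
import Literature.MathematicalPhysics.QuantumFieldTheory.BalabanImbrieJaffe1984to88.BIJ88Sect3Normalization
import Literature.MathematicalPhysics.QuantumFieldTheory.BalabanImbrieJaffe1984to88.BIJ88Sect3Rescaling
import Literature.MathematicalPhysics.QuantumFieldTheory.BalabanImbrieJaffe1984to88.BIJ88Decomposition314

/-!
# `BalabanImbrieJaffe1984to88.BIJ88RenormTransf311` — T. Bałaban, J. Imbrie, A. Jaffe, *Effective action and cluster properties
of the abelian Higgs model*, Commun. Math. Phys. **114** (1988) 257–315 [BalabanImbrieJaffe1988], pp. 266–267: the first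
renormalization transformation **(3.11)** (with the axial gauge fix `δ_{Ax}(u)` and the block-average constraints `δ(v/Qu)`,
`exp(−½aL⁻²⟨ψ − Q(u)φ, ψ − Q(u)φ⟩ − E^{(0)})` of [2] = [BalabanImbrieJaffe1985] (3.3)–(3.6)) TYPED on the torus carrier of record,
and its normalization **(3.13)** `[F] = ∫dv dψ ρ₁^L(v, ψ)` PROVED.

statement-level skeleton of published theorems with citation tags; proofs where landed; nothing here is a claim about the Yang–Mills mass gap

PDF held: `paper:balaban1988-cmp114-bij-abelian-higgs-effective-action` (journal page = PDF page + 256); pp. 266–268 [PDF 10–12]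
read as images (poppler ×2.4 renders `renders/c2-p010.png … c2-p012.png` of the r18 gen-3 seat folder; crops
`HOME/lit-balaban-r18/renders/c2/c2-p010a/b.png`).  [2] = T. Bałaban, J. Imbrie, A. Jaffe, *Renormalization of the Higgs model:
minimizers, propagators and the stability of mean field theory*, Commun. Math. Phys. **97** (1985) 299–329, p. 306 [PDF 8]
((3.3)–(3.7); typed by seat p03 on the `ℤ^d` dictionary: `BIJ85AxialGauge34` / `BIJ85AxialGauge35`, decls of record of row
`C1.Eq3.4-3.6`).

CITATION HEADER (lean-in-tree rule).  Part of the lit-balaban TYPED SKELETON (HOME `run/shared/lean/pub/lit-balaban/`): rows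
`C2.Eq3.11`, `C2.Eq3.13` (v1) and `C2.Eq3.22` (v1.1) of `HOME/lit-balaban-r18/ROWS-C2.md` (unit `lit-balaban-r18`, fold owner of C2 Sects. 1–4, gen 3).

THE PRINTED TEXT (p. 266 [PDF 10] – p. 267 [PDF 11], verbatim).  *"We begin to compute [F] by integrating over u, φ under
constraints given by the block fields v, ψ on the L-lattice. This is the renormalization transformation, described in the
previous paper. With the gauge fix δ_{Ax}(u), it takes the density ρ₀(u, φ) to
ρ₁^L(v, ψ) = ∫𝒟u𝒟φ δ(v/Qu)δ_{Ax}(u)F exp[−Σ_p e₀⁻²(1 − Re u(p)) − ½aL⁻²⟨ψ − Q(u)φ, ψ − Q(u)φ⟩ − ½⟨φ, −Δ_uφ⟩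
− Σ_x P₀(φ(x)) − Σ_x ½δm²ε²|φ(x)|² − ℰ₀ − E^{(0)} − E₁]. (3.11)  Here we define E^{(0)} = −|T₁^{(1)}| log(aL^{d−2}/2π), (3.12)
which normalizes the transformation so that [F] = ∫dv dψ ρ₁^L(v, ψ). (3.13)"*; and [2] p. 306: *"(𝒯e^{−S})(v, ψ) =
∫e^{−S(u,φ)}δ_{Ax}(u)δ(v/Qu)δ_H(ψ − Qφ)𝒟u𝒟φ. (3.3) In (3.3) we specify the axial gauge with δ_{Ax}(u) which sets u_b = 1 on the
set of bonds chosen as follows: Within each L-block B(y) with corner y in the L-lattice, let T(y) denote the tree composed of unit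
bonds in Γ_{yx}. Here x ranges over B(y), and T(y) is maximal … Then δ_{Ax}(u) = Π_{y∈T_L} Π_{b∈T(y)} δ(u_b). (3.4) … The integral
(3.2) therefore has the normalization property ∫𝒯e^{−S}𝒟v𝒟ψ = ∫e^{−S}𝒟u𝒟φ, (3.7)"*.

CARRIERS (all of record; nothing re-declared).  The unit lattice `T₁` = the torus `Balaban1983to89.Site P j` of `Setup`
(`PBond`, `GaugeField P j U1` with `U1 = Matrix.unitaryGroup (Fin 1) ℂ` and the product Haar PROBABILITY measure `fieldMeasure`
= `𝒟u` — p. 274: *"The measure du is the normalized measure on U(1)"*), the Higgs field `φ : Balaban1983to89.Site P j → ℂ` with Lebesgue measure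
`𝒟φ` (as in `BIJ88Sect3Statements.bracket`, the typed (3.1)); the `L`-lattice `T₁^{(1)}` = `Balaban1983to89.Site P (j+1)` with its blocks
`Balaban1983to89.block` (`blockOf x = ⌊x/L⌋` coordinatewise, so the block `B(y)` consists of the labels `yL, …, yL + L − 1` and its
CORNER is the label `yL`, [2] (2.4)), block gauge fields `v : GaugeField P (j+1) U1` (`dv` = `fieldMeasure P (j+1) U1`), block
scalar fields `ψ : Balaban1983to89.Site P (j+1) → ℂ` (`dψ` = Lebesgue).  Standing range `j + 1 ≤ m + K` of `Setup.Params` (then every block has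
exactly `L` sites per direction, `TorusGeometry.sitesPerDir_eq_mul_succ`).

WHAT IS TYPED / PROVED, and how.
* §1 **`δ_{Ax}(u)` of (3.11) = [2] (3.4) ON THE TORUS OF RECORD.**  `IsAxialBond b`: the bond `b = ⟨x, x + e_μ⟩` lies in the block
  tree `T(y)` of its block — `x` agrees with the corner of its block in every direction `κ < μ` and `x + e_μ` stays in the block
  (the `ℤ^d` decl of record is p03's `BIJ85AxialGauge34.IsTreeBond`; the same comb as `Balaban1983to89.T4AxialGaugeFixing.combSet`
  of one box); `axialBonds` (all of them), `DeltaAx U` (= the support `u_b = 1 on every tree bond` of `δ_{Ax}`).  PROVED: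
  `treeOrder_axialBonds` — the union of the block trees carries a `T4AxialGaugeFixing.TreeOrder` (fresh end = `b₊`, rank = the
  `ℓ¹`-position inside the block), i.e. it is a forest to which the cell's measure-level tree gauge fixing applies; tree bonds are
  intra-block (`blockOf_tgt`).  `axialMeasure` := the push-forward of `𝒟u` under `U ↦ U[axialBonds := 1]` — THIS IS
  `∫𝒟u δ_{Ax}(u)(·)` (a product of Dirac masses at `1` on the tree bonds and normalized Haar measures elsewhere; `integral_axialMeasure`),
  a probability measure supported on `DeltaAx`; and the Faddeev–Popov identity WITH UNIT DETERMINANT `integral_axialMeasure_eq`: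
  `∫𝒟u δ_{Ax}(u) K(u) = ∫𝒟u K(u)` for every measurable gauge-invariant `K : GaugeField → ℂ` (from the cell's
  `T4AxialGaugeFixing.map_eq_map_fixBonds`, [folklore]; print: [2] p. 306 "(3.7)").
* §2 **(3.11) TYPED** in the push-forward reading which is the tree's convention for `δ`-function scans (`Setup.IsRT`, cell file
  DIVERGENCE.md F7): `IsRT311 Qu Qφ a ρ₀ ρ₁` says that `ρ₁ = ρ₁^L` is a `(v, ψ)`-density of the image of the measure
  `δ_{Ax}(u)ρ₀(u, φ)𝒟u𝒟φ ⊗ [(aL^{d−2}/2π)^{|T₁^{(1)}|} exp(−½aL⁻²⟨ψ − Q(u)φ, ψ − Q(u)φ⟩) dψ]` under `(u, φ, ψ) ↦ (Qu, ψ)`: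
  `∫dv dψ ρ₁(v, ψ) g(v, ψ) = ∫𝒟u δ_{Ax}(u) ∫𝒟φ ρ₀(u, φ) ∫dψ exp(−½aL⁻²⟨ψ − Q(u)φ, ψ − Q(u)φ⟩ − E^{(0)}) g(Qu, ψ)` for all bounded
  measurable test functions `g` — with the `U(1)` block averages `Qu` ([2] (2.10), decl of record `BIJ85AxialGauge35.qU` /
  `BIJ85Sect1Model.argB`) and `Q(u)φ` ([2] (2.6), `BIJ85CellAverages.Cells.Qcov` / `BIJ85AxialGauge35.qCov`) entering as DATA
  (functions on the torus carrier), `a > 0` the parameter of [2] (3.6), the Gaussian weight `gaussWeight` (= the integrand of r18's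
  `BIJ88Sect3Normalization.blockGaussian_integral_eq_one`, `E^{(0)}` = `BIJ88Sect3Statements.E0step` (3.12)), and the density
  `ρ₀` of (3.7) — either abstract, or THE MODEL'S: `rho0 ε e λ δm² E₀ E₁ F` = `F · exp(−S^ε)` at the rescaled scalar field
  `ε^{−(d−2)/2}φ` with `E₀ ↦ ℰ₀` (3.10), which IS the printed (3.7) by p34's `BIJ88Sect3Rescaling.action_rescale_eq_BIJ85` and for
  which (3.6) `[F] = ∫𝒟u𝒟φ ρ₀` is `bracket_eq_integral_rho0` (from p34's `bracket_rescale`).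
* §3 **(3.13) PROVED**: `integral_eq_of_isRT311` — for every `ρ₁` with `IsRT311 Qu Qφ a ρ₀ ρ₁` (`a > 0`, `d ≥ 2`, standing range),
  every jointly measurable `ρ₀` such that `u ↦ ∫𝒟φ ρ₀(u, φ)` is gauge invariant, and ANY `Qu`, `Qφ`:
  `∫dv dψ ρ₁(v, ψ) = ∫𝒟u𝒟φ ρ₀(u, φ)` — test `g ≡ 1`, the `ψ`-Gaussian integrates to `1` by (3.12) (r18 p243748), `δ(v/Qu)` integrates
  to `1` (push-forward of a point), and `δ_{Ax}` drops by §1's unit-Jacobian tree gauge fixing; and the headline `eq313`: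
  `[F] = ∫dv dψ ρ₁^L(v, ψ)` for the model's `ρ₀` and every jointly gauge-invariant measurable observable `F` (p. 265 *"F is a
  gauge-invariant function"*), via (3.6) and the gauge invariance of `u ↦ ∫𝒟φ ρ₀(u, φ)` (`gaugeInvariant_integral_rho0`: joint
  invariance of `F e^{−S}` — `BIJ88Sect3Statements.action_gauge` — plus rotation invariance of `𝒟φ`, Mathlib `rotation` /
  `LinearIsometryEquiv.measurePreserving`).
* §4 (v1.1, append-only) **(3.22) TYPED** — *"Our density now takes the following form"*: the same renormalization
  transformation read with a `(u, φ, ψ)`-dependent integrand (`IsRTOf`; `IsRT311` is the case `ρ₀(u, φ)·[ψ-Gaussian]`,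
  `isRT311_iff_isRTOf`), the bracket of (3.22) as the DEFINED function `Term322.integrand` of one term (one small-field region
  `Λ₀^{(0)}` with its component families `{X_ω}`, `{X_σ}`: the factor `ζ_{Λ₀^{(0)c}}χ_{Λ₀^{(0)}}` of (3.14)/(3.15) — it involves
  `ψ − Q(u)φ` —, the large-field factors `g₀(X_ω)` (3.20) and the local observable factors `F_{0,loc}(X_σ)` (3.21) of r18's
  `BIJ88Sect3Expansion` as functions of `(u, φ)`, the quadratic form `½⟨Λ₀^{(0)**}f^{(0)}, Λ₀^{(0)**}f^{(0)}⟩` with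
  `f^{(0)}(p) = (ie₀)⁻¹ log u(p)` (`BIJ88Sect3Statements.fieldStrength`), `½⟨φ, (−Δ_u)φ⟩ = ½Σ_b |(D_uφ)(b)|²`
  (`BIJ88Sect3Statements.covD` at `c = 1`), `𝒫_{0,loc}(Λ₀^{(0)})` (3.23), `ℰ₀`, and the `ψ`-Gaussian with `E^{(0)}`), the density
  `density322` = the double sum over terms, and the display **(3.22)** as the `Prop` `Eq322`; PROVED: `Eq322 ↔ IsRT311` whenever the
  (3.22) integrand equals `ρ₀·[ψ-Gaussian]` pointwise (`eq322_iff_isRT311` — the rewriting (3.14)–(3.21) entering as that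
  hypothesis; its first operation, the insertion of the partition of unity (3.14), is `insert314` from r18's
  `BIJ88Decomposition314.eq314`), hence (3.13) for the decomposed density (`bracket_eq_of_eq322`).
NOT DONE HERE (honest scope).  The EXISTENCE of a density `ρ₁` with `IsRT311 …` (a Radon–Nikodym derivative, cf.
`Balaban1983to89.AveragingRT.rnTransport`; it needs the Haar-compatibility of `u ↦ Q(u^{Ax})`, [2] Sect. 2, not typed in the tree)
is not constructed: (3.13) is proved for every `ρ₁` that (3.11) defines.  The grouping of the expansions (3.18)–(3.19) into the
connected components `{X_ω}` of `Λ₁₃^{(−1)c}` (p. 268) is DATA of `Term322`, not constructed.  No new `Prop`-valued fact is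
introduced; every theorem below is kernel-checked; standard axioms.
-/

namespace Literature.MathematicalPhysics.QuantumFieldTheory.BalabanImbrieJaffe1984to88.BIJ88RenormTransf311

open Literature.MathematicalPhysics.QuantumFieldTheory.Balaban1983to89
open Literature.MathematicalPhysics.QuantumFieldTheory.BalabanImbrieJaffe1984to88.BIJ88Sect3Statements
open T4AxialGaugeFixing (TreeOrder fixBonds measurable_fixBonds map_eq_map_fixBonds)
open BIJ85Sect1Model (HiggsField)
open scoped BigOperators
open _root_.MeasureTheory Complex Finset Function

noncomputable section

variable {P : Params} {j : ℕ}

/-- kernel (plumbing): decidability of equality of bonds, through the pair (source, direction) — needed to freeze a `Finset`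
of bond variables (`T4AxialGaugeFixing.fixBonds`). [folklore] -/
private instance instDecEqPBond : DecidableEq (PBond P j) := fun a b =>
  decidable_of_iff (a.src = b.src ∧ a.dir = b.dir)
    ⟨fun h => by cases a; cases b; cases h; congr, fun h => by subst h; exact ⟨rfl, rfl⟩⟩

/-! ## §1 The axial gauge `δ_{Ax}(u)` of (3.11) (= [2] (3.4)) on the torus `T₁` of record -/

/-- The position of the site `x` inside its `L`-block, in the direction `κ`: the label of `x` modulo `L` (the block of `x` is
`blockOf x = ⌊x/L⌋`, its corner has all positions `0`). [cite: BalabanImbrieJaffe1988, (3.11) p.266] -/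
def inBlock (x : Balaban1983to89.Site P j) (κ : Fin P.d) : ℕ := (x κ).val % P.L

/-- `b = ⟨x, x + e_μ⟩` is a bond of the block tree `T(y)` of its own block `B(y)` ([2] (3.4): the unit bonds of the contours
`Γ_{yx}` from the corner `y`, `x ∈ B(y)`): `x` agrees with the corner in every direction `κ < μ`, and `x + e_μ` stays inside the
block.  (`ℤ^d` decl of record: `BIJ85AxialGauge34.IsTreeBond`; one box: `Balaban1983to89.T4AxialGaugeFixing.combSet`.)
[cite: BalabanImbrieJaffe1988, (3.11) p.266] -/
def IsAxialBond (b : PBond P j) : Prop := (∀ κ : Fin P.d, κ < b.dir → inBlock b.src κ = 0) ∧ inBlock b.src b.dir + 1 < P.L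

/-- kernel (plumbing): the tree-bond condition is decidable. [folklore] -/
instance instDecidablePredIsAxialBond : DecidablePred (IsAxialBond (P := P) (j := j)) := fun b => by
  unfold IsAxialBond; infer_instance

/-- The set of all tree bonds `⋃_{y∈T_L} T(y)` — the bonds on which *"δ_{Ax}(u) … sets u_b = 1"* ([2] (3.4)).
[cite: BalabanImbrieJaffe1988, (3.11) p.266] -/
def axialBonds : Finset (PBond P j) := Finset.univ.filter IsAxialBond

/-- kernel: membership in `axialBonds`. [cite: BalabanImbrieJaffe1988, (3.11) p.266] -/
theorem mem_axialBonds {b : PBond P j} : b ∈ (axialBonds : Finset (PBond P j)) ↔ IsAxialBond b := by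
  simp [axialBonds]

/-- **`δ_{Ax}(u)` of (3.11)** (= [2] (3.4) *"δ_{Ax}(u) = Π_{y∈T_L} Π_{b∈T(y)} δ(u_b)"*), typed by its support: `u_b = 1` on every
tree bond of every block. [cite: BalabanImbrieJaffe1988, (3.11) p.266] -/
def DeltaAx {G : Type*} [GaugeGroup G] (U : GaugeField P j G) : Prop := ∀ b ∈ (axialBonds : Finset (PBond P j)), U b = 1

/-- The `ℓ¹`-position of a site inside its block (the rank along which the block trees are peeled). [cite: BalabanImbrieJaffe1988, (3.11) p.266] -/
def blockRank (x : Balaban1983to89.Site P j) : ℕ := ∑ κ : Fin P.d, inBlock x κ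

/-- kernel (plumbing): in the standing range `L` divides the number of sites per direction. [folklore] -/
private theorem L_dvd_sitesPerDir (hj : j + 1 ≤ P.m + P.K) : P.L ∣ P.sitesPerDir j :=
  Dvd.intro_left _ (P.sitesPerDir_eq_mul_succ hj).symm

/-- kernel (plumbing): one step in direction `μ` from a site that is not at the far face of its block raises the label by one,
without wrapping around the torus. [folklore] -/
private theorem val_add_one (hj : j + 1 ≤ P.m + P.K) {s : ZMod (P.sitesPerDir j)} (hs : s.val % P.L + 1 < P.L) :
    (s + 1).val = s.val + 1 := by
  have hlt : s.val < P.sitesPerDir j := ZMod.val_lt s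
  have hne : s.val + 1 ≠ P.sitesPerDir j := by
    intro h
    obtain ⟨q, hq⟩ := L_dvd_sitesPerDir (P := P) hj
    have h0 : (s.val + 1) % P.L = 0 := by rw [h, hq, Nat.mul_mod_right]
    have h1 : (s.val + 1) % P.L = s.val % P.L + 1 := by
      rw [Nat.add_mod, Nat.one_mod_eq_one.mpr (by have := P.hL.2; omega), Nat.mod_eq_of_lt hs]
    omega
  rw [ZMod.val_add, ZMod.val_one, Nat.mod_eq_of_lt (by omega)]

/-- kernel (plumbing): … and raises the position inside the block by one. [folklore] -/
private theorem mod_val_add_one (hj : j + 1 ≤ P.m + P.K) {s : ZMod (P.sitesPerDir j)} (hs : s.val % P.L + 1 < P.L) :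
    (s + 1).val % P.L = s.val % P.L + 1 := by
  rw [val_add_one hj hs, Nat.add_mod, Nat.one_mod_eq_one.mpr (by have := P.hL.2; omega), Nat.mod_eq_of_lt hs]

/-- kernel: the coordinates of the end-point `b₊ = x + e_μ` of a bond `b = ⟨x, x + e_μ⟩`. [folklore] -/
private theorem tgt_apply (b : PBond P j) (κ : Fin P.d) :
    b.tgt κ = if κ = b.dir then b.src b.dir + 1 else b.src κ := by
  simp only [PBond.tgt, Balaban1983to89.Site.shift, Function.update_apply]

/-- Along a tree bond the position inside the block increases by one in the direction of the bond and is unchanged in the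
other directions. [cite: BalabanImbrieJaffe1988, (3.11) p.266] -/
theorem inBlock_tgt (hj : j + 1 ≤ P.m + P.K) {b : PBond P j} (hb : IsAxialBond b) (κ : Fin P.d) :
    inBlock b.tgt κ = if κ = b.dir then inBlock b.src b.dir + 1 else inBlock b.src κ := by
  unfold inBlock
  rw [tgt_apply]
  split_ifs with h
  · exact mod_val_add_one hj hb.2
  · rfl

/-- Tree bonds are INTRA-BLOCK: `b₊` lies in the block of `b₋` ([2] (3.4): `T(y)` is made of bonds of `B(y)`).
[cite: BalabanImbrieJaffe1988, (3.11) p.266] -/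
theorem blockOf_tgt (hj : j + 1 ≤ P.m + P.K) {b : PBond P j} (hb : IsAxialBond b) : blockOf b.tgt = blockOf b.src := by
  funext κ
  simp only [blockOf]
  rw [tgt_apply]
  split_ifs with h
  · have hlt : (b.src b.dir).val % P.L + 1 < P.L := hb.2
    have h1 : (1 : ℕ) % P.L = 1 := Nat.one_mod_eq_one.mpr (by have := P.hL.2; omega)
    have hdiv : ((b.src b.dir).val + 1) / P.L = (b.src b.dir).val / P.L := by
      rw [Nat.add_div_eq_of_add_mod_lt (by rw [h1]; exact hlt), Nat.div_eq_of_lt (by have := P.hL.2; omega : 1 < P.L),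
        add_zero]
    rw [val_add_one hj hb.2, hdiv, h]
  · rfl

/-- The rank increases by exactly one along every tree bond. [cite: BalabanImbrieJaffe1988, (3.11) p.266] -/
theorem blockRank_tgt (hj : j + 1 ≤ P.m + P.K) {b : PBond P j} (hb : IsAxialBond b) :
    blockRank b.tgt = blockRank b.src + 1 := by
  unfold blockRank
  rw [← Finset.add_sum_erase _ _ (Finset.mem_univ b.dir), ← Finset.add_sum_erase _ _ (Finset.mem_univ b.dir),
    inBlock_tgt hj hb, if_pos rfl]
  have : ∑ κ ∈ Finset.univ.erase b.dir, inBlock b.tgt κ = ∑ κ ∈ Finset.univ.erase b.dir, inBlock b.src κ :=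
    Finset.sum_congr rfl fun κ hκ => by rw [inBlock_tgt hj hb, if_neg (Finset.ne_of_mem_erase hκ)]
  rw [this]
  ring

/-- A bond of the torus is never a loop (`sitesPerDir ≥ 2`). [folklore] -/
private theorem src_ne_tgt (b : PBond P j) : b.src ≠ b.tgt := by
  intro h
  have h1 := congr_fun h b.dir
  rw [tgt_apply, if_pos rfl] at h1
  have h2 : (1 : ZMod (P.sitesPerDir j)) = 0 := by
    have := congrArg (fun z => z - b.src b.dir) h1
    simpa using this.symm
  exact one_ne_zero h2

/-- **The block trees form a forest**: `axialBonds` carries a `T4AxialGaugeFixing.TreeOrder` (fresh end of `b` = `b₊`, rank =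
`blockRank`) — distinct tree bonds have distinct end-points (the typed content of [2] *"T(y) is maximal … adjoining any
additional unit bond … makes T(y) multiply connected"* that the gauge fixing uses; `ℤ^d`: p03's `BIJ85AxialGauge35.tip_injOn`).
[cite: BalabanImbrieJaffe1988, (3.11) p.266] -/
theorem treeOrder_axialBonds (hj : j + 1 ≤ P.m + P.K) :
    TreeOrder (axialBonds : Finset (PBond P j)) (fun b => b.tgt) blockRank where
  endpoint := fun _ _ => Or.inr rfl
  ne := fun b _ => src_ne_tgt b
  inj := by
    intro b hb b' hb' h
    rw [mem_axialBonds] at hb hb'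
    have hco : ∀ κ, b.tgt κ = b'.tgt κ := fun κ => congr_fun h κ
    -- the directions agree
    have hdir : b.dir = b'.dir := by
      by_contra hne
      rcases lt_or_gt_of_ne hne with hlt | hgt
      · -- `b.dir < b'.dir`: the position of `b'₋` (hence of `b'₊`) in direction `b.dir` is `0`, that of `b₊` is positive
        have h1 : inBlock b'.tgt b.dir = 0 := by
          rw [inBlock_tgt hj hb' b.dir, if_neg (ne_of_lt hlt)]; exact hb'.1 _ hlt
        have h2 : inBlock b.tgt b.dir = inBlock b.src b.dir + 1 := by rw [inBlock_tgt hj hb b.dir, if_pos rfl]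
        have h3 : inBlock b.tgt b.dir = inBlock b'.tgt b.dir := by simp only [inBlock, hco]
        omega
      · have h1 : inBlock b.tgt b'.dir = 0 := by
          rw [inBlock_tgt hj hb b'.dir, if_neg (ne_of_lt hgt)]; exact hb.1 _ hgt
        have h2 : inBlock b'.tgt b'.dir = inBlock b'.src b'.dir + 1 := by rw [inBlock_tgt hj hb' b'.dir, if_pos rfl]
        have h3 : inBlock b.tgt b'.dir = inBlock b'.tgt b'.dir := by simp only [inBlock, hco]
        omega
    -- hence the sources agree
    have hsrc : b.src = b'.src := by
      funext κ
      have e := hco κ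
      rw [tgt_apply, tgt_apply, ← hdir] at e
      by_cases hκ : κ = b.dir
      · subst hκ
        rw [if_pos rfl, if_pos rfl] at e
        exact add_right_cancel e
      · rw [if_neg hκ, if_neg hκ] at e
        exact e
    cases b; cases b'
    simp only at hdir hsrc
    subst hdir; subst hsrc; rfl
  rank := fun b hb => Or.inl (by rw [blockRank_tgt hj (mem_axialBonds.1 hb)]; exact Nat.lt_succ_self _)

/-! ### `∫𝒟u δ_{Ax}(u)(·)` as a measure, and the unit Faddeev–Popov factor -/

section Measure

variable {G : Type*} [GaugeGroup G] [MeasurableSpace G] [HaarData G]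

/-- **`∫𝒟u δ_{Ax}(u) (·)`** as a measure on gauge fields: the product of the Dirac masses `δ(u_b)` at `1` on the tree bonds and
of the normalized Haar measures `du_b` on the other bonds — the push-forward of `𝒟u` under freezing the tree bonds,
`U ↦ U[axialBonds := 1]` (`T4AxialGaugeFixing.fixBonds`). [cite: BalabanImbrieJaffe1988, (3.11) p.266] -/
def axialMeasure (P : Params) (j : ℕ) (G : Type*) [GaugeGroup G] [MeasurableSpace G] [HaarData G] : Measure (GaugeField P j G) :=
  (fieldMeasure P j G).map (fixBonds axialBonds)

omit [MeasurableSpace G] [HaarData G] in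
/-- kernel: the frozen configuration `U[axialBonds := 1]` is in axial gauge. [cite: BalabanImbrieJaffe1988, (3.11) p.266] -/
theorem deltaAx_fixBonds (U : GaugeField P j G) : DeltaAx (fixBonds axialBonds U) :=
  fun _ hb => T4AxialGaugeFixing.fixBonds_apply_of_mem hb U

/-- kernel: `∫𝒟u δ_{Ax}(u)` is a probability measure (`∫du_b = 1` on every bond, `∫δ(u_b)du_b = 1` on the tree bonds).
[cite: BalabanImbrieJaffe1988, (3.11) p.266] -/
instance isProbabilityMeasure_axialMeasure : IsProbabilityMeasure (axialMeasure P j G) := by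
  haveI : ∀ _ : PBond P j, IsProbabilityMeasure (HaarData.haar : Measure G) := fun _ => HaarData.isProb
  haveI : IsProbabilityMeasure (fieldMeasure P j G) := by
    unfold fieldMeasure; exact Measure.pi.instIsProbabilityMeasure _
  exact Measure.isProbabilityMeasure_map (measurable_fixBonds _).aemeasurable

omit [HaarData G] in
/-- kernel: the set of axial-gauge configurations is measurable (finitely many coordinate conditions `u_b = 1`). [folklore] -/
private theorem measurableSet_deltaAx [MeasurableSingletonClass G] :
    MeasurableSet {U : GaugeField P j G | DeltaAx U} := by
  have e : {U : GaugeField P j G | DeltaAx U} = ⋂ b ∈ (axialBonds : Finset (PBond P j)), (fun U : GaugeField P j G => U b) ⁻¹' {1} := by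
    ext U
    simp only [DeltaAx, Set.mem_setOf_eq, Set.mem_iInter, Set.mem_preimage, Set.mem_singleton_iff]
  rw [e]
  exact Finset.measurableSet_biInter _ fun b _ => measurable_pi_apply b (MeasurableSet.singleton 1)

/-- **`∫𝒟u δ_{Ax}(u)(·)` is supported on the axial gauge**: almost every configuration under `axialMeasure` has `u_b = 1` on
every tree bond ([2] (3.4)). [cite: BalabanImbrieJaffe1988, (3.11) p.266] -/
theorem ae_deltaAx_axialMeasure [MeasurableSingletonClass G] : ∀ᵐ U ∂axialMeasure P j G, DeltaAx U := by
  unfold axialMeasure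
  exact (ae_map_iff (measurable_fixBonds _).aemeasurable measurableSet_deltaAx).2
    (Filter.Eventually.of_forall deltaAx_fixBonds)

/-- kernel: integrating against `∫𝒟u δ_{Ax}(u)(·)` IS integrating `K(u|_{trees} = 1)` over all bond variables — the operational
content of *"δ_{Ax}(u) … sets u_b = 1"* on the tree bonds. [cite: BalabanImbrieJaffe1988, (3.11) p.266] -/
theorem integral_axialMeasure {E : Type*} [NormedAddCommGroup E] [NormedSpace ℝ E] [MeasurableSpace E] [BorelSpace E]
    [SecondCountableTopology E] {K : GaugeField P j G → E} (hK : Measurable K) :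
    ∫ U, K U ∂axialMeasure P j G = ∫ U, K (fixBonds axialBonds U) ∂fieldMeasure P j G := by
  unfold axialMeasure
  rw [integral_map (measurable_fixBonds _).aemeasurable hK.aestronglyMeasurable]

variable [MeasurableMul G]

/-- **The axial gauge fix costs nothing on gauge-invariant integrands (unit Faddeev–Popov determinant of the tree gauge):**
`∫𝒟u δ_{Ax}(u) K(u) = ∫𝒟u K(u)` for every measurable gauge-invariant `K` — the mechanism of [2] (3.7) and of (3.13); from the
cell's measure-level tree gauge fixing `T4AxialGaugeFixing.map_eq_map_fixBonds` applied to the forest `treeOrder_axialBonds`.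
[cite: BalabanImbrieJaffe1988, (3.13) p.267] -/
theorem integral_axialMeasure_eq (hj : j + 1 ≤ P.m + P.K) {E : Type*} [NormedAddCommGroup E] [NormedSpace ℝ E]
    [MeasurableSpace E] [BorelSpace E] [SecondCountableTopology E] {K : GaugeField P j G → E} (hK : Measurable K)
    (hinv : GaugeField.GaugeInvariant K) :
    ∫ U, K U ∂axialMeasure P j G = ∫ U, K U ∂fieldMeasure P j G := by
  rw [integral_axialMeasure hK]
  have hK' : Measurable fun U : GaugeField P j G => K (fixBonds axialBonds U) := hK.comp (measurable_fixBonds _)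
  have h1 : ∫ U, K (fixBonds axialBonds U) ∂fieldMeasure P j G =
      ∫ z, z ∂(fieldMeasure P j G).map (fun U => K (fixBonds axialBonds U)) :=
    (integral_map hK'.aemeasurable aestronglyMeasurable_id).symm
  have h2 : ∫ U, K U ∂fieldMeasure P j G = ∫ z, z ∂(fieldMeasure P j G).map K :=
    (integral_map hK.aemeasurable aestronglyMeasurable_id).symm
  rw [h1, h2, map_eq_map_fixBonds (treeOrder_axialBonds hj) hK hinv]

end Measure

/-! ## §2 (3.11): the renormalization transformation with the axial gauge fix, typed by its push-forward identity -/

/-- The block-field Gaussian of (3.11) with its normalization (3.12):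
`exp(−½aL⁻²⟨ψ − c, ψ − c⟩ − E^{(0)})`, `⟨f, g⟩ = Σ_{y∈T₁^{(1)}} L^d f̄(y)g(y)` the `L`-lattice inner product, centre `c = Q(u)φ`,
`E^{(0)} = −|T₁^{(1)}| log(aL^{d−2}/2π)` (`BIJ88Sect3Statements.E0step`) — i.e. [2] (3.6) `δ_H(ψ − Qφ) = Π_y (a′/2π)exp(−½a′|ψ − Q(u)φ|²)`
with `a′ = aL^{d−2}`. [cite: BalabanImbrieJaffe1988, (3.11) p.266] -/
def gaussWeight (a : ℝ) (c ψ : Balaban1983to89.Site P (j+1) → ℂ) : ℝ :=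
  Real.exp (-(1 / 2) * (a * (P.L : ℝ)⁻¹ ^ 2) * (∑ y, (P.L : ℝ) ^ P.d * ‖ψ y - c y‖ ^ 2)
    - E0step (Fintype.card (Balaban1983to89.Site P (j+1))) a P.L P.d)

/-- kernel: `gaussWeight > 0`. [cite: BalabanImbrieJaffe1988, (3.11) p.266] -/
theorem gaussWeight_pos (a : ℝ) (c ψ : Balaban1983to89.Site P (j+1) → ℂ) : 0 < gaussWeight a c ψ := Real.exp_pos _

/-- **(3.12) normalizes the `ψ`-Gaussian of (3.11)**: `∫dψ exp(−½aL⁻²⟨ψ − c, ψ − c⟩ − E^{(0)}) = 1` for every centre `c`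
(`a > 0`, `d ≥ 2`; r18's `BIJ88Sect3Normalization.blockGaussian_integral_eq_one` on the block lattice `T₁^{(1)}`).
[cite: BalabanImbrieJaffe1988, (3.12) p.267] -/
theorem integral_gaussWeight {a : ℝ} (ha : 0 < a) (hd : 2 ≤ P.d) (c : Balaban1983to89.Site P (j+1) → ℂ) :
    ∫ ψ, gaussWeight (P := P) (j := j) a c ψ = 1 :=
  BIJ88Sect3Normalization.blockGaussian_integral_eq_one ha P.cast_L_pos hd c

/-- **(3.7) → (3.11): the density `ρ₀(u, φ)` of the MODEL** — `ρ₀ = F · exp[−S]` with `S` the `ε`-lattice action (3.3)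
(`BIJ88Sect3Statements.actionU1`, weights `w = ε^d`, `c = ε⁻¹`) evaluated at the rescaled scalar field `ε^{−(d−2)/2}φ` (p. 266: *"The
scalar field is multiplied by ε^{−(d−2)/2} … Each factor φ in F acquires a factor ε^{−(d−2)/2}, but we use the same notation"*) and
with `E₀` replaced by `ℰ₀` (3.10) (`BIJ88Sect3Statements.calE0`); that this exponent IS the printed
`−Σ_p e₀⁻²(1 − Re u(p)) − ½⟨φ, −Δ_uφ⟩ − Σ_x P₀(φ(x)) − Σ_x ½δm²ε²|φ(x)|² − ℰ₀ − E₁` of (3.7)/(3.11) is p34's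
`BIJ88Sect3Rescaling.action_rescale_eq_BIJ85` (with the `δm²`-sign note GAPS G-C2-01 recorded there).
[cite: BalabanImbrieJaffe1988, (3.7) p.266] -/
def rho0 (ε e lam dm2 E₀ E₁ : ℝ) (F : GaugeField P j U1 → HiggsField P j → ℂ) (U : GaugeField P j U1) (φ : HiggsField P j) : ℂ :=
  (Real.exp (-(actionU1 (ε ^ P.d) ε⁻¹ e lam dm2 (calE0 E₀ P.d (Fintype.card (Balaban1983to89.Site P j)) ε) E₁ U
      (BIJ88Sect3Rescaling.phiScale ε P.d • φ))) : ℂ) * F U (BIJ88Sect3Rescaling.phiScale ε P.d • φ)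

/-- **(3.6) for `rho0`**: `[F] = ∫𝒟u𝒟φ ρ₀(u, φ)` — the typed unnormalized expectation (3.1) (`BIJ88Sect3Statements.bracket`) of
the `ε`-lattice action equals the `𝒟u𝒟φ`-integral of `rho0` (p34's `BIJ88Sect3Rescaling.bracket_rescale` and
`actionU1_rescale_eq_BIJ85`; holds for every `F`, both sides taking the junk value together). [cite: BalabanImbrieJaffe1988, (3.6) p.266] -/
theorem bracket_eq_integral_rho0 {ε : ℝ} (hε : 0 < ε) (e lam dm2 E₀ E₁ : ℝ) (F : GaugeField P j U1 → HiggsField P j → ℂ) :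
    bracket (actionU1 (ε ^ P.d) ε⁻¹ e lam dm2 E₀ E₁) F =
      ∫ U, ∫ φ, rho0 ε e lam dm2 E₀ E₁ F U φ ∂volume ∂fieldMeasure P j U1 := by
  rw [BIJ88Sect3Rescaling.bracket_rescale hε]
  simp only [rho0, BIJ88Sect3Rescaling.actionU1_rescale_eq_BIJ85 hε]

/-- **(3.11)** p. 266 [PDF 10] — *"ρ₁^L(v, ψ) = ∫𝒟u𝒟φ δ(v/Qu)δ_{Ax}(u)F exp[−Σ_p e₀⁻²(1 − Re u(p)) − ½aL⁻²⟨ψ − Q(u)φ, ψ − Q(u)φ⟩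
− ½⟨φ, −Δ_uφ⟩ − Σ_x P₀(φ(x)) − Σ_x ½δm²ε²|φ(x)|² − ℰ₀ − E^{(0)} − E₁]"* — TYPED in the push-forward reading of the `δ`-functions (the
tree's convention, `Balaban1983to89.IsRT`): `ρ₁ : (v, ψ) ↦ ρ₁^L(v, ψ)` is a density, with respect to `dv dψ` (product Haar
probability measure on the `L`-lattice gauge fields × Lebesgue measure on the block scalar fields), of the image under
`(u, φ, ψ) ↦ (Qu, ψ)` of the measure `δ_{Ax}(u)𝒟u ⊗ ρ₀(u, φ)𝒟φ ⊗ exp(−½aL⁻²⟨ψ − Q(u)φ, ψ − Q(u)φ⟩ − E^{(0)})dψ`: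
for every bounded measurable test function `g(v, ψ)`,
`∫dv∫dψ ρ₁(v, ψ)g(v, ψ) = ∫𝒟u δ_{Ax}(u) ∫𝒟φ ∫dψ ρ₀(u, φ) exp(−½aL⁻²⟨ψ − Q(u)φ, ψ − Q(u)φ⟩ − E^{(0)}) g(Qu, ψ)`.
DATA: the `U(1)` block average of the gauge field `Qu` ([2] (2.10)–(2.11); decls of record `BIJ85AxialGauge35.qU`,
`BIJ85Sect1Model.argB`) and the covariant block average of the scalar field `Q(u)φ` ([2] (2.6); `BIJ85CellAverages.Cells.Qcov`,
`BIJ85AxialGauge35.qCov`) as functions on the torus carrier, the parameter `a > 0` of [2] (3.6), and the density `ρ₀` of (3.7)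
(the model's is `rho0`). [cite: BalabanImbrieJaffe1988, (3.11) p.266] -/
def IsRT311 (Qu : GaugeField P j U1 → GaugeField P (j+1) U1)
    (Qφ : GaugeField P j U1 → HiggsField P j → (Balaban1983to89.Site P (j+1) → ℂ)) (a : ℝ)
    (ρ₀ : GaugeField P j U1 → HiggsField P j → ℂ)
    (ρ₁ : GaugeField P (j+1) U1 → (Balaban1983to89.Site P (j+1) → ℂ) → ℂ) : Prop :=
  ∀ g : GaugeField P (j+1) U1 × (Balaban1983to89.Site P (j+1) → ℂ) → ℂ, Measurable g → (∃ C : ℝ, ∀ z, ‖g z‖ ≤ C) →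
    ∫ v, ∫ ψ, ρ₁ v ψ * g (v, ψ) ∂volume ∂fieldMeasure P (j+1) U1 =
      ∫ U, ∫ φ, ∫ ψ, ρ₀ U φ * (gaussWeight a (Qφ U φ) ψ : ℂ) * g (Qu U, ψ) ∂volume ∂volume ∂axialMeasure P j U1

/-! ## §3 (3.13): the normalization of the renormalization transformation, PROVED -/

/-- **(3.13), abstract form: the renormalization transformation (3.11) preserves the total integral.**  For every `ρ₁` that
(3.11) defines (`IsRT311 Qu Qφ a ρ₀ ρ₁`; ANY block averages `Qu`, `Qφ`; `a > 0`, `d ≥ 2`, standing range) and every jointly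
measurable `ρ₀` whose `φ`-integral `u ↦ ∫𝒟φ ρ₀(u, φ)` is gauge invariant:  `∫dv dψ ρ₁(v, ψ) = ∫𝒟u𝒟φ ρ₀(u, φ)`.
Mechanism ([2] (3.7) *"The integral (3.2) therefore has the normalization property ∫𝒯e^{−S}𝒟v𝒟ψ = ∫e^{−S}𝒟u𝒟φ"*): test (3.11)
against `g ≡ 1`; the `ψ`-Gaussian integrates to `1` by (3.12) (`integral_gaussWeight`); `δ(v/Qu)` integrates to `1`; and the gauge
fix `δ_{Ax}(u)` drops out of a gauge-invariant integrand with unit Jacobian (`integral_axialMeasure_eq`).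
[cite: BalabanImbrieJaffe1988, (3.13) p.267] -/
theorem integral_eq_of_isRT311 (hj : j + 1 ≤ P.m + P.K) (hd : 2 ≤ P.d) {a : ℝ} (ha : 0 < a)
    {Qu : GaugeField P j U1 → GaugeField P (j+1) U1}
    {Qφ : GaugeField P j U1 → HiggsField P j → (Balaban1983to89.Site P (j+1) → ℂ)}
    {ρ₀ : GaugeField P j U1 → HiggsField P j → ℂ} {ρ₁ : GaugeField P (j+1) U1 → (Balaban1983to89.Site P (j+1) → ℂ) → ℂ}
    (h : IsRT311 Qu Qφ a ρ₀ ρ₁) (hρm : Measurable (uncurry ρ₀))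
    (hρg : GaugeField.GaugeInvariant fun U => ∫ φ, ρ₀ U φ) :
    ∫ v, ∫ ψ, ρ₁ v ψ ∂volume ∂fieldMeasure P (j+1) U1 = ∫ U, ∫ φ, ρ₀ U φ ∂volume ∂fieldMeasure P j U1 := by
  have h1 := h (fun _ => (1 : ℂ)) measurable_const ⟨1, fun _ => by simp⟩
  simp only [mul_one] at h1
  rw [h1]
  have hin : ∀ (U : GaugeField P j U1) (φ : HiggsField P j),
      ∫ ψ, ρ₀ U φ * (gaussWeight a (Qφ U φ) ψ : ℂ) = ρ₀ U φ := fun U φ => by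
    rw [integral_const_mul, integral_complex_ofReal, integral_gaussWeight ha hd, Complex.ofReal_one, mul_one]
  simp_rw [hin]
  have hK : Measurable fun U : GaugeField P j U1 => ∫ φ, ρ₀ U φ :=
    (hρm.stronglyMeasurable.integral_prod_right).measurable
  exact integral_axialMeasure_eq hj hK hρg

/-! ### The model's `ρ₀`: measurability, gauge invariance of its `φ`-integral, and (3.13) as printed -/

/-- kernel (plumbing): `toC : U(1) → ℂ` (the matrix entry) is continuous. [folklore] -/
private theorem continuous_toC : Continuous (toC : U1 → ℂ) := by
  unfold toC
  exact (continuous_apply_apply 0 0).comp continuous_subtype_val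

/-- kernel (plumbing): reading a `U(1)` configuration as a ℂ-valued bond field is measurable. [folklore] -/
private theorem measurable_cfg : Measurable (cfg : GaugeField P j U1 → PBond P j → ℂ) :=
  measurable_pi_lambda _ fun b => continuous_toC.measurable.comp (measurable_pi_apply b)

/-- kernel (plumbing): the `ε`-lattice action (3.3) is jointly continuous in the ℂ-valued bond field and the scalar field. [folklore] -/
private theorem continuous_action (w c e lam dm2 E₀ E₁ : ℝ) :
    Continuous fun q : (PBond P j → ℂ) × HiggsField P j => action w c e lam dm2 E₀ E₁ q.1 q.2 := by
  unfold action plaqVar covD higgsP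
  fun_prop

/-- **`ρ₀` is jointly measurable** in `(u, φ)` for every jointly measurable observable `F`. [cite: BalabanImbrieJaffe1988, (3.7) p.266] -/
theorem measurable_rho0 (ε e lam dm2 E₀ E₁ : ℝ) {F : GaugeField P j U1 → HiggsField P j → ℂ} (hF : Measurable (uncurry F)) :
    Measurable (uncurry (rho0 ε e lam dm2 E₀ E₁ F)) := by
  set s : ℝ := BIJ88Sect3Rescaling.phiScale ε P.d with hs_def
  set E₀' : ℝ := calE0 E₀ P.d (Fintype.card (Balaban1983to89.Site P j)) ε with hE_def
  have huc : uncurry (rho0 ε e lam dm2 E₀ E₁ F) = fun p : GaugeField P j U1 × HiggsField P j =>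
      (Real.exp (-(action (ε ^ P.d) ε⁻¹ e lam dm2 E₀' E₁ (cfg p.1) (s • p.2))) : ℂ) * uncurry F (p.1, s • p.2) := by
    funext p
    rfl
  rw [huc]
  have hsm : Measurable fun p : GaugeField P j U1 × HiggsField P j => s • p.2 :=
    (measurable_const_smul s).comp measurable_snd
  have hs : Measurable fun p : GaugeField P j U1 × HiggsField P j => (p.1, s • p.2) := measurable_fst.prodMk hsm
  have hq : Measurable fun p : GaugeField P j U1 × HiggsField P j => (cfg p.1, s • p.2) :=
    (measurable_cfg.comp measurable_fst).prodMk hsm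
  have hA : Measurable fun q : (PBond P j → ℂ) × HiggsField P j => action (ε ^ P.d) ε⁻¹ e lam dm2 E₀' E₁ q.1 q.2 :=
    (continuous_action _ _ _ _ _ _ _).measurable
  have hS := hA.comp hq
  have hE := Complex.measurable_ofReal.comp (hS.neg.exp)
  exact hE.mul (hF.comp hs)

/-- kernel (plumbing): `exp(−i arg z) = z̄` for `|z| = 1`. [folklore] -/
private theorem exp_neg_arg_mul_I {z : ℂ} (hz : ‖z‖ = 1) : exp (-((arg z : ℂ) * I)) = (starRingEnd ℂ) z := by
  have h1 : exp ((arg z : ℂ) * I) = z := by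
    have := Complex.norm_mul_exp_arg_mul_I z
    rwa [hz, Complex.ofReal_one, one_mul] at this
  have h2 : -((arg z : ℂ) * I) = (starRingEnd ℂ) ((arg z : ℂ) * I) := by
    rw [map_mul, conj_ofReal, conj_I]; ring
  rw [h2, exp_conj, h1]

/-- kernel (plumbing): `exp(i arg z) = z` for `|z| = 1`. [folklore] -/
private theorem exp_arg_mul_I {z : ℂ} (hz : ‖z‖ = 1) : exp ((arg z : ℂ) * I) = z := by
  have := Complex.norm_mul_exp_arg_mul_I z
  rwa [hz, Complex.ofReal_one, one_mul] at this

/-- The tree's gauge action on `U(1)` configurations, read as ℂ-valued bond fields, is the phase gauge transformation of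
`BIJ88Sect3Statements` with phases `λ(x) = arg u(x)`: `cfg(U^g) = gaugeU λ (cfg U)`. [cite: BalabanImbrieJaffe1988, (1.1) p.258] -/
theorem cfg_gaugeAct (g : GaugeTransf P j U1) (U : GaugeField P j U1) :
    cfg (GaugeField.gaugeAct g U) = gaugeU (fun x => arg (toC (g x))) (cfg U) := by
  funext b
  simp only [cfg, GaugeField.gaugeAct, gaugeU, toC_mul, toC_inv, exp_arg_mul_I (norm_toC _),
    exp_neg_arg_mul_I (norm_toC _)]

/-- … and the scalar field rotates by the same phases: `(x ↦ u(x)φ(x)) = gaugePhi λ φ`. [cite: BalabanImbrieJaffe1988, (4.16) p.276] -/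
theorem rot_eq_gaugePhi (g : GaugeTransf P j U1) (φ : HiggsField P j) :
    (fun x => toC (g x) * φ x) = gaugePhi (fun x => arg (toC (g x))) φ := by
  funext x
  simp only [gaugePhi, exp_arg_mul_I (norm_toC _)]

/-- **`ρ₀(u^g, φ^g) = ρ₀(u, φ)`**: the model's density is jointly gauge invariant when the observable is (p. 265: *"F is a
gauge-invariant function"*; the action by `BIJ88Sect3Statements.action_gauge`). [cite: BalabanImbrieJaffe1988, (3.7) p.266] -/
theorem rho0_gaugeAct (ε e lam dm2 E₀ E₁ : ℝ) {F : GaugeField P j U1 → HiggsField P j → ℂ}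
    (hF : ∀ (g : GaugeTransf P j U1) (U : GaugeField P j U1) (φ : HiggsField P j),
      F (GaugeField.gaugeAct g U) (fun x => toC (g x) * φ x) = F U φ)
    (g : GaugeTransf P j U1) (U : GaugeField P j U1) (φ : HiggsField P j) :
    rho0 ε e lam dm2 E₀ E₁ F (GaugeField.gaugeAct g U) (fun x => toC (g x) * φ x) = rho0 ε e lam dm2 E₀ E₁ F U φ := by
  have hsm : BIJ88Sect3Rescaling.phiScale ε P.d • (fun x => toC (g x) * φ x) =
      fun x => toC (g x) * (BIJ88Sect3Rescaling.phiScale ε P.d • φ) x := by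
    funext x
    simp only [Pi.smul_apply, Complex.real_smul]
    ring
  unfold rho0
  rw [hsm, hF]
  congr 3
  simp only [actionU1]
  rw [cfg_gaugeAct, rot_eq_gaugePhi]
  exact congrArg Neg.neg (action_gauge _ _ _ _ _ _ _ _ _ _)

/-- The sitewise phase rotation `φ ↦ (x ↦ u(x)φ(x))` of the scalar fields, as a measurable equivalence of `ℂ^{T₁}` (Mathlib's
`rotation` on each factor). [cite: BalabanImbrieJaffe1988, (4.16) p.276] -/
def rotField (g : GaugeTransf P j U1) : HiggsField P j ≃ᵐ HiggsField P j :=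
  MeasurableEquiv.piCongrRight fun x => (rotation (BIJ88Sect3Rescaling.circleEquivU1.symm (g x))).toMeasurableEquiv

/-- kernel: `rotField g φ x = u(x) φ(x)`. [cite: BalabanImbrieJaffe1988, (4.16) p.276] -/
theorem rotField_apply (g : GaugeTransf P j U1) (φ : HiggsField P j) :
    rotField g φ = fun x => toC (g x) * φ x := by
  funext x
  rfl

/-- **Lebesgue measure `𝒟φ` on `ℂ^{T₁}` is invariant under the sitewise phase rotations** (each factor is a rotation of the
plane). [cite: BalabanImbrieJaffe1988, (4.16) p.276] -/
theorem measurePreserving_rotField (g : GaugeTransf P j U1) :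
    MeasurePreserving (rotField g) (volume : Measure (HiggsField P j)) volume :=
  volume_preserving_pi fun x => (rotation (BIJ88Sect3Rescaling.circleEquivU1.symm (g x))).measurePreserving

/-- **The `φ`-integral of `ρ₀` is a gauge-invariant function of `u`** — `∫𝒟φ ρ₀(u^g, φ) = ∫𝒟φ ρ₀(u, φ)`: substitute `φ = φ′^g`
(`𝒟φ` is rotation invariant) and use the joint invariance `rho0_gaugeAct`.  This is the hypothesis under which the axial gauge
fix is free (`integral_axialMeasure_eq`). [cite: BalabanImbrieJaffe1988, (3.13) p.267] -/
theorem gaugeInvariant_integral_rho0 (ε e lam dm2 E₀ E₁ : ℝ) {F : GaugeField P j U1 → HiggsField P j → ℂ}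
    (hF : ∀ (g : GaugeTransf P j U1) (U : GaugeField P j U1) (φ : HiggsField P j),
      F (GaugeField.gaugeAct g U) (fun x => toC (g x) * φ x) = F U φ) :
    GaugeField.GaugeInvariant fun U => ∫ φ, rho0 ε e lam dm2 E₀ E₁ F U φ := by
  intro g U
  show ∫ φ, rho0 ε e lam dm2 E₀ E₁ F (GaugeField.gaugeAct g U) φ = ∫ φ, rho0 ε e lam dm2 E₀ E₁ F U φ
  rw [← (measurePreserving_rotField g).integral_comp' (fun φ => rho0 ε e lam dm2 E₀ E₁ F (GaugeField.gaugeAct g U) φ)]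
  refine integral_congr_ae (Filter.Eventually.of_forall fun φ => ?_)
  simp only [rotField_apply]
  exact rho0_gaugeAct ε e lam dm2 E₀ E₁ hF g U φ

/-- **(3.13)** p. 267 [PDF 11], verbatim: *"Here we define E^{(0)} = −|T₁^{(1)}| log(aL^{d−2}/2π), (3.12) which normalizes the
transformation so that [F] = ∫dv dψ ρ₁^L(v, ψ). (3.13)"* — PROVED for the typed (3.1) `[F]` (`BIJ88Sect3Statements.bracket` of the
`ε`-lattice action (3.3)) and EVERY `ρ₁^L` that (3.11) defines from the model's density `rho0` (any block averages `Qu`, `Q(u)φ`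
of [2]; `a > 0`; `d ≥ 2`; standing range), for every jointly measurable, jointly gauge-invariant observable `F` (p. 265 *"F is a
gauge-invariant function, a product of terms like |φ(x)|², φ̄(b₋)u(b)φ(b₊), Re(ieε²)⁻¹(u(p) − 1)"*).  Chain: (3.6)
`bracket_eq_integral_rho0` · `integral_eq_of_isRT311` ((3.12) Gaussian normalization + unit-Jacobian axial gauge fixing) ·
`gaugeInvariant_integral_rho0`. [cite: BalabanImbrieJaffe1988, (3.13) p.267] -/
theorem eq313 (hj : j + 1 ≤ P.m + P.K) (hd : 2 ≤ P.d) {a ε : ℝ} (ha : 0 < a) (hε : 0 < ε) (e lam dm2 E₀ E₁ : ℝ)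
    {Qu : GaugeField P j U1 → GaugeField P (j+1) U1}
    {Qφ : GaugeField P j U1 → HiggsField P j → (Balaban1983to89.Site P (j+1) → ℂ)}
    {F : GaugeField P j U1 → HiggsField P j → ℂ} (hFm : Measurable (uncurry F))
    (hFg : ∀ (g : GaugeTransf P j U1) (U : GaugeField P j U1) (φ : HiggsField P j),
      F (GaugeField.gaugeAct g U) (fun x => toC (g x) * φ x) = F U φ)
    {ρ₁ : GaugeField P (j+1) U1 → (Balaban1983to89.Site P (j+1) → ℂ) → ℂ}
    (h : IsRT311 Qu Qφ a (rho0 ε e lam dm2 E₀ E₁ F) ρ₁) :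
    bracket (actionU1 (ε ^ P.d) ε⁻¹ e lam dm2 E₀ E₁) F = ∫ v, ∫ ψ, ρ₁ v ψ ∂volume ∂fieldMeasure P (j+1) U1 := by
  rw [bracket_eq_integral_rho0 hε,
    integral_eq_of_isRT311 hj hd ha h (measurable_rho0 ε e lam dm2 E₀ E₁ hFm) (gaugeInvariant_integral_rho0 ε e lam dm2 E₀ E₁ hFg)]

/-! ## §4 (v1.1, append-only) (3.22): the density after the large/small-field decomposition — TYPED -/

/-- The renormalization transformation of (3.11) read with a GENERAL `(u, φ, ψ)`-dependent integrand `K` (needed from (3.22) on,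
where the small-field characteristic functions involve the block field `ψ` through `|ψ − Q(u)φ| ≦ p(e₀)`, (3.15)): `ρ₁` is the
`(v, ψ)`-density of the image under `(u, φ, ψ) ↦ (Qu, ψ)` of `δ_{Ax}(u)𝒟u ⊗ 𝒟φ ⊗ K(u, φ, ψ)dψ` — for every bounded measurable test
function `g`, `∫dv∫dψ ρ₁(v, ψ)g(v, ψ) = ∫𝒟u δ_{Ax}(u)∫𝒟φ∫dψ K(u, φ, ψ) g(Qu, ψ)`. [cite: BalabanImbrieJaffe1988, (3.22) p.268] -/
def IsRTOf (Qu : GaugeField P j U1 → GaugeField P (j+1) U1)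
    (K : GaugeField P j U1 → HiggsField P j → (Balaban1983to89.Site P (j+1) → ℂ) → ℂ)
    (ρ₁ : GaugeField P (j+1) U1 → (Balaban1983to89.Site P (j+1) → ℂ) → ℂ) : Prop :=
  ∀ g : GaugeField P (j+1) U1 × (Balaban1983to89.Site P (j+1) → ℂ) → ℂ, Measurable g → (∃ C : ℝ, ∀ z, ‖g z‖ ≤ C) →
    ∫ v, ∫ ψ, ρ₁ v ψ * g (v, ψ) ∂volume ∂fieldMeasure P (j+1) U1 =
      ∫ U, ∫ φ, ∫ ψ, K U φ ψ * g (Qu U, ψ) ∂volume ∂volume ∂axialMeasure P j U1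

/-- kernel: (3.11) is the case `K(u, φ, ψ) = ρ₀(u, φ)·exp(−½aL⁻²⟨ψ − Q(u)φ, ψ − Q(u)φ⟩ − E^{(0)})` of `IsRTOf`.
[cite: BalabanImbrieJaffe1988, (3.11) p.266] -/
theorem isRT311_iff_isRTOf (Qu : GaugeField P j U1 → GaugeField P (j+1) U1)
    (Qφ : GaugeField P j U1 → HiggsField P j → (Balaban1983to89.Site P (j+1) → ℂ)) (a : ℝ)
    (ρ₀ : GaugeField P j U1 → HiggsField P j → ℂ) (ρ₁ : GaugeField P (j+1) U1 → (Balaban1983to89.Site P (j+1) → ℂ) → ℂ) :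
    IsRT311 Qu Qφ a ρ₀ ρ₁ ↔ IsRTOf Qu (fun U φ ψ => ρ₀ U φ * (gaussWeight a (Qφ U φ) ψ : ℂ)) ρ₁ :=
  Iff.rfl

/-- kernel: the renormalization transform depends on the integrand only through its values. [cite: BalabanImbrieJaffe1988, (3.22) p.268] -/
theorem isRTOf_congr {Qu : GaugeField P j U1 → GaugeField P (j+1) U1}
    {K K' : GaugeField P j U1 → HiggsField P j → (Balaban1983to89.Site P (j+1) → ℂ) → ℂ} (h : ∀ U φ ψ, K U φ ψ = K' U φ ψ)
    (ρ₁ : GaugeField P (j+1) U1 → (Balaban1983to89.Site P (j+1) → ℂ) → ℂ) : IsRTOf Qu K ρ₁ ↔ IsRTOf Qu K' ρ₁ := by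
  have e : K = K' := funext fun U => funext fun φ => funext fun ψ => h U φ ψ
  rw [e]

/-- *"The first operation is a decomposition of the lattice into large and small field regions. This is accomplished by means of
a partition of unity, 1 = Σ_{Λ₀^{(0)}} ζ_{Λ₀^{(0)c}}χ_{Λ₀^{(0)}}. (3.14)"* (p. 267) — inserting (3.14) under the integral of (3.11)
does not change the integrand: `Σ_{Λ₀ ⊆ cubes} ζ_{cubes∖Λ₀}χ_{Λ₀} · K = K` (r18's `BIJ88Decomposition314.eq314`, any per-cube
factors `χ_□`, e.g. the indicators `BIJ88Decomposition314.chi315` of the conditions (3.15)). [cite: BalabanImbrieJaffe1988, (3.14) p.267] -/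
theorem insert314 {κ : Type*} [DecidableEq κ] (cubes : Finset κ) (χ : κ → ℝ) (K : ℂ) :
    ∑ Λ₀ ∈ cubes.powerset, ((BIJ88Decomposition314.zeta χ (cubes \ Λ₀) * BIJ88Decomposition314.chi χ Λ₀ : ℝ) : ℂ) * K = K := by
  rw [← Finset.sum_mul, ← Complex.ofReal_sum, BIJ88Decomposition314.eq314, Complex.ofReal_one, one_mul]

/-- The DATA of one term of (3.22) — one small-field region `Λ₀^{(0)}` together with one family `{X_ω}` of connected components of
`Λ₁₃^{(−1)c}` and the components `{X_σ}` of the remaining cubes covering the support of `F` (p. 268) — and the objects the bracket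
of (3.22) multiplies, as functions of the unit-lattice fields `u` (ℂ-valued bond field), `φ` and the block field `ψ`.
[cite: BalabanImbrieJaffe1988, (3.22) p.268] -/
structure Term322 (P : Params) (j : ℕ) where
  /-- the small-field region `Λ₀^{(0)} ⊂ T₁` (a union of r(e₀)-cubes), as its set of sites -/
  Λ₀ : Finset (Balaban1983to89.Site P j)
  /-- index type of the large-field components `X_ω` of this term -/
  Ω : Type
  [fintypeΩ : Fintype Ω]
  /-- index type of the observable components `X_σ` of this term -/
  Obs : Type
  [fintypeObs : Fintype Obs]
  /-- the factor `ζ_{Λ₀^{(0)c}}χ_{Λ₀^{(0)}}` of (3.14) on the configuration — the conditions (3.15) involve `D_uφ`, `ψ − Q(u)φ`,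
  `φ` and `f^{(0)}`, hence `(u, φ, ψ)` (sharp reading: `BIJ88Decomposition314.zeta`/`chi` of the indicators `chi315`) -/
  zetaChi : (PBond P j → ℂ) → HiggsField P j → (Balaban1983to89.Site P (j+1) → ℂ) → ℝ
  /-- the large-field factors `g₀(X_ω)` (3.20) as functions of `(u, φ)` (`BIJ88Sect3Expansion.g0` of the component's data) -/
  g0 : Ω → (PBond P j → ℂ) → HiggsField P j → ℂ
  /-- the local observable factors `F_{0,loc}(X_σ)` (3.21) (`BIJ88Sect3Expansion.F0loc`) -/
  F0loc : Obs → (PBond P j → ℂ) → HiggsField P j → ℂ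
  /-- the running charge `e₀` of `f^{(0)}(p) = (ie₀)⁻¹ log u(p)` ((3.15); `e₀ = e(ε)`, (2.2)/(3.9)) -/
  e₀ : ℝ
  /-- the basic interaction `𝒫_{0,loc}(Λ₀^{(0)})` (3.23) as a function of `(u, φ)` (`BIJ88Sect3Statements.P0loc` with
  `V₀(p) = V₀(f^{(0)}(p))`) -/
  P0loc : (PBond P j → ℂ) → HiggsField P j → ℝ
  /-- the constant `ℰ₀` (3.10) -/
  calE0 : ℝ

attribute [instance] Term322.fintypeΩ Term322.fintypeObs

/-- THE BRACKET OF **(3.22)** for one term, p. 268 [PDF 12], verbatim: *"ζ_{Λ₀^{(0)c}}χ_{Λ₀^{(0)}} × Π_ω g₀(X_ω) Π_σ F_{0,loc}(X_σ)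
exp[−½⟨Λ₀^{(0)**}f^{(0)}, Λ₀^{(0)**}f^{(0)}⟩ − ½aL⁻²⟨ψ − Q(u)φ, ψ − Q(u)φ⟩ − ½⟨φ, (−Δ_u)φ⟩ − 𝒫_{0,loc}(Λ₀^{(0)}) − ℰ₀ − E^{(0)}]"* —
as a function of `(u, φ, ψ)`: `⟨Λ₀**f, Λ₀**f⟩ = Σ_{p∈Λ₀**} |f^{(0)}(p)|²` (`starP`, `fieldStrength`), `⟨φ, (−Δ_u)φ⟩ = Σ_b |(D_uφ)(b)|²`
on the unit lattice (`covD 1`), the `ψ`-terms being `gaussWeight` (incl. `E^{(0)}`). [cite: BalabanImbrieJaffe1988, (3.22) p.268] -/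
def Term322.integrand (T : Term322 P j) (a : ℝ)
    (Qφ : GaugeField P j U1 → HiggsField P j → (Balaban1983to89.Site P (j+1) → ℂ))
    (U : GaugeField P j U1) (φ : HiggsField P j) (ψ : Balaban1983to89.Site P (j+1) → ℂ) : ℂ :=
  (T.zetaChi (cfg U) φ ψ : ℂ) * (∏ ω : T.Ω, T.g0 ω (cfg U) φ) * (∏ σ : T.Obs, T.F0loc σ (cfg U) φ) *
    (Real.exp (-(1 / 2) * (∑ p ∈ starP T.Λ₀, ‖fieldStrength T.e₀ (plaqVar (cfg U) p)‖ ^ 2)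
        - (1 / 2) * (∑ b : PBond P j, ‖covD 1 (cfg U) φ b‖ ^ 2) - T.P0loc (cfg U) φ - T.calE0) : ℂ) *
      (gaussWeight a (Qφ U φ) ψ : ℂ)

/-- The integrand of (3.22) summed over its terms — *"Σ_{Λ₀^{(0)}} Σ_{{X_ω}}"* (a finite family of `Term322` data, one per
small-field region and component family). [cite: BalabanImbrieJaffe1988, (3.22) p.268] -/
def density322 {ι : Type*} (terms : Finset ι) (T : ι → Term322 P j) (a : ℝ)
    (Qφ : GaugeField P j U1 → HiggsField P j → (Balaban1983to89.Site P (j+1) → ℂ))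
    (U : GaugeField P j U1) (φ : HiggsField P j) (ψ : Balaban1983to89.Site P (j+1) → ℂ) : ℂ :=
  ∑ t ∈ terms, (T t).integrand a Qφ U φ ψ

/-- unfolding: no terms, no density. [cite: BalabanImbrieJaffe1988, (3.22) p.268] -/
theorem density322_empty {ι : Type*} (T : ι → Term322 P j) (a : ℝ)
    (Qφ : GaugeField P j U1 → HiggsField P j → (Balaban1983to89.Site P (j+1) → ℂ))
    (U : GaugeField P j U1) (φ : HiggsField P j) (ψ : Balaban1983to89.Site P (j+1) → ℂ) :
    density322 (∅ : Finset ι) T a Qφ U φ ψ = 0 := by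
  simp [density322]

/-- **(3.22)** p. 268 [PDF 12], verbatim: *"Our density now takes the following form:
ρ₁^L(v, ψ) = Σ_{Λ₀^{(0)}} Σ_{{X_ω}} ∫𝒟u𝒟φ δ(v/Qu)δ_{Ax}(u)ζ_{Λ₀^{(0)c}}χ_{Λ₀^{(0)}} × Π_ω g₀(X_ω) Π_σ F_{0,loc}(X_σ)
exp[−½⟨Λ₀^{(0)**}f^{(0)}, Λ₀^{(0)**}f^{(0)}⟩ − ½aL⁻²⟨ψ − Q(u)φ, ψ − Q(u)φ⟩ − ½⟨φ, (−Δ_u)φ⟩ − 𝒫_{0,loc}(Λ₀^{(0)}) − ℰ₀ − E^{(0)}],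
(3.22)"* — TYPED as the push-forward identity `IsRTOf` for the summed integrand `density322` (the `δ`-functions read as in (3.11)).
[cite: BalabanImbrieJaffe1988, (3.22) p.268] -/
def Eq322 {ι : Type*} (Qu : GaugeField P j U1 → GaugeField P (j+1) U1)
    (Qφ : GaugeField P j U1 → HiggsField P j → (Balaban1983to89.Site P (j+1) → ℂ)) (a : ℝ) (terms : Finset ι)
    (T : ι → Term322 P j) (ρ₁ : GaugeField P (j+1) U1 → (Balaban1983to89.Site P (j+1) → ℂ) → ℂ) : Prop :=
  IsRTOf Qu (density322 terms T a Qφ) ρ₁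

/-- **(3.22) is (3.11) with the integrand rewritten**: whenever the decomposed integrand equals `ρ₀(u, φ)·[ψ-Gaussian]` pointwise
(the content of (3.14)–(3.21): partition of unity `insert314`, the splittings (3.16)/(3.17) `BIJ88Sect3Statements.eq316`/`eq317`, the
expansion (3.18) `BIJ88Sect3Expansion.eq318`, the Mayer expansion (3.19) `BIJ88Sect3Statements.mayer_319`, and the grouping into the
components `{X_ω}` — the last being data here), a function `ρ₁` satisfies (3.22) iff it satisfies (3.11).
[cite: BalabanImbrieJaffe1988, (3.22) p.268] -/
theorem eq322_iff_isRT311 {ι : Type*} {Qu : GaugeField P j U1 → GaugeField P (j+1) U1}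
    {Qφ : GaugeField P j U1 → HiggsField P j → (Balaban1983to89.Site P (j+1) → ℂ)} {a : ℝ} {terms : Finset ι}
    {T : ι → Term322 P j} {ρ₀ : GaugeField P j U1 → HiggsField P j → ℂ}
    (h : ∀ U φ ψ, density322 terms T a Qφ U φ ψ = ρ₀ U φ * (gaussWeight a (Qφ U φ) ψ : ℂ))
    (ρ₁ : GaugeField P (j+1) U1 → (Balaban1983to89.Site P (j+1) → ℂ) → ℂ) :
    Eq322 Qu Qφ a terms T ρ₁ ↔ IsRT311 Qu Qφ a ρ₀ ρ₁ := by
  rw [Eq322, isRT311_iff_isRTOf]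
  exact isRTOf_congr h ρ₁

/-- Hence **(3.13) for the decomposed density (3.22)**: if the (3.22) integrand is the rewritten model density `rho0·[ψ-Gaussian]`,
every `ρ₁^L` satisfying (3.22) has total integral `[F]` (standing hypotheses of `eq313`). [cite: BalabanImbrieJaffe1988, (3.22) p.268] -/
theorem bracket_eq_of_eq322 {ι : Type*} (hj : j + 1 ≤ P.m + P.K) (hd : 2 ≤ P.d) {a ε : ℝ} (ha : 0 < a) (hε : 0 < ε)
    (e lam dm2 E₀ E₁ : ℝ) {Qu : GaugeField P j U1 → GaugeField P (j+1) U1}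
    {Qφ : GaugeField P j U1 → HiggsField P j → (Balaban1983to89.Site P (j+1) → ℂ)}
    {F : GaugeField P j U1 → HiggsField P j → ℂ} (hFm : Measurable (uncurry F))
    (hFg : ∀ (g : GaugeTransf P j U1) (U : GaugeField P j U1) (φ : HiggsField P j),
      F (GaugeField.gaugeAct g U) (fun x => toC (g x) * φ x) = F U φ)
    {terms : Finset ι} {T : ι → Term322 P j}
    (h : ∀ U φ ψ, density322 terms T a Qφ U φ ψ = rho0 ε e lam dm2 E₀ E₁ F U φ * (gaussWeight a (Qφ U φ) ψ : ℂ))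
    {ρ₁ : GaugeField P (j+1) U1 → (Balaban1983to89.Site P (j+1) → ℂ) → ℂ} (h322 : Eq322 Qu Qφ a terms T ρ₁) :
    bracket (actionU1 (ε ^ P.d) ε⁻¹ e lam dm2 E₀ E₁) F = ∫ v, ∫ ψ, ρ₁ v ψ ∂volume ∂fieldMeasure P (j+1) U1 :=
  eq313 hj hd ha hε e lam dm2 E₀ E₁ hFm hFg ((eq322_iff_isRT311 h ρ₁).1 h322)

end

end Literature.MathematicalPhysics.QuantumFieldTheory.BalabanImbrieJaffe1984to88.BIJ88RenormTransf311
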